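import Summits.ABC.ABC.Theses.GlobalQuasiLogDerivative

/-!
# Refutation of `GlobalQuasiLogDerivative.SeparatingQuasiLogDerivatives` (stmt-ABC-1689)

The target quantifies over EVERY abc triple in the sense of
`Literature.NumberTheory.DiophantineGeometry.IsABCTriple a b c := 0 < a ∧ 0 < b ∧ a + b = c ∧
Nat.Coprime a b`, which includes the degenerate triple `(1, 1, 2)` (`Nat.Coprime 1 1`).  At that
triple the separation clause `rad a · k b ≠ rad b · k a` reads `rad 1 · k 1 ≠ rad 1 · k 1`, which
no `k : ℕ → ℤ` satisfies.  Hence the statement is false as typed, for every `ε > 0` and every `C`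
(witness `ε = 1`).  The coherence and smallness clauses play no role.

Planner fix (not a mathematical objection to the line): demand separation only for triples with
`a ≠ b` (equivalently `a < b`); `(1,1,2)` is the only abc triple with `a = b`, and it satisfies
`c < C · rad(abc)^{1+ε}` trivially, so `Bridge` is unaffected by the exclusion.  Until the repair,
`Bridge` and `Assembly` of the same route are provable ex falso and `SeparationUpgrade` is
literally `¬ SmallCoherentNonConstant`.

First observed by refuter seat `refuter-rreview-route-HubbardSuperconduc-9a1ee903-0`
(evidence `Refutation.lean` on stmt-ABC-1689, 2026-08-15T11:23Z); landed here. [folklore]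
The refuted decl was then replaced in the route by `SeparatingQuasiLogDerivativesR` (`a ≠ b` guard);
it is re-created privately below, so the theorem's (append-only) statement is unchanged and nothing
depends on the retired route name.
-/

/-- PRIVATE re-creation (route namespace stays free; a refuted statement, NOT a cited fact) of the
route decl `…Theses.GlobalQuasiLogDerivative.SeparatingQuasiLogDerivatives`, stmt-ABC-1689, which the
planner REPLACED by the guarded `SeparatingQuasiLogDerivativesR` after the refutation below, so the
name left `Theses/GlobalQuasiLogDerivative.lean` (full-build breakage 2026-08-16,
`Unknown identifier`): the item's recorded signature verbatim, so that the append-only refuting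
theorem keeps elaborating. -/
private def Summit.ABC.ABC.Theses.GlobalQuasiLogDerivative.SeparatingQuasiLogDerivatives : Prop :=
  ∀ ε : ℝ, 0 < ε → ∃ C : ℝ, ∀ a b c : ℕ, Literature.NumberTheory.DiophantineGeometry.IsABCTriple a b c →
    ∃ k : ℕ → ℤ,
      (∀ x y : ℕ, 0 < x → 0 < y → Nat.Coprime x y →
        ((x + y : ℕ) : ℤ) ∣ ((UniqueFactorizationMonoid.radical (x + y) : ℕ) : ℤ) *
          (((UniqueFactorizationMonoid.radical x : ℕ) : ℤ) * k y -
            ((UniqueFactorizationMonoid.radical y : ℕ) : ℤ) * k x)) ∧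
      (∀ x y : ℕ, 0 < x → 0 < y → Nat.Coprime x y →
        |((UniqueFactorizationMonoid.radical x : ℕ) : ℝ) * (k y : ℝ) -
            ((UniqueFactorizationMonoid.radical y : ℕ) : ℝ) * (k x : ℝ)| ≤
          C * ((UniqueFactorizationMonoid.radical x : ℕ) : ℝ) *
            ((UniqueFactorizationMonoid.radical y : ℕ) : ℝ) * ((x + y : ℕ) : ℝ) ^ ε) ∧
      ((UniqueFactorizationMonoid.radical a : ℕ) : ℤ) * k b ≠
        ((UniqueFactorizationMonoid.radical b : ℕ) : ℤ) * k a

namespace Summit.ABC.ABC.Theorems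

/-- Refutes `GlobalQuasiLogDerivative.SeparatingQuasiLogDerivatives`: the abc triple `(1,1,2)`
(`IsABCTriple 1 1 2` holds since `Nat.Coprime 1 1`) admits no `k` with
`rad 1 · k 1 ≠ rad 1 · k 1`; witness `ε = 1`, triple `(1,1,2)`. [folklore] -/
theorem GlobalQuasiLogDerivativeSeparatingQuasiLogDerivatives_refuted :
    ¬ Summit.ABC.ABC.Theses.GlobalQuasiLogDerivative.SeparatingQuasiLogDerivatives := by
  intro h
  obtain ⟨C, hC⟩ := h 1 one_pos
  obtain ⟨k, -, -, hsep⟩ := hC 1 1 2 ⟨Nat.one_pos, Nat.one_pos, rfl, Nat.coprime_one_right 1⟩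
  exact hsep rfl

end Summit.ABC.ABC.Theorems
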